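import Mathlib
import Literature.NumberTheory.Automorphic.GaloisActionPlaces
import Summits.Langlands.Langlands.Theorems.PicardMuOrdinaryResidualAutomorphyEvenTower
import Summits.Langlands.Langlands.Theorems.PicardMuOrdinaryResidualAutomorphyEvenQuarticDisc

/-!
# Frobenius on the four roots, read modulo a prime (Stage D1 of `ResidualAutomorphyEven`)

Helper file for item stmt-Langlands-13760 (route `PicardMuOrdinary`).  Let `W` be a prime of `𝓞 M`
(`M` the splitting field of the quartic `f` over `K = ℚ(ω)`) above the place `v` of `K`, and
`g ∈ G = Gal(M/K)` an arithmetic Frobenius at `W` (Mathlib `IsArithFrobAt (𝓞 K) g W`: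
`g x ≡ x^{Nv} (mod W)`).  The integral elements `xᵢ = a₄ rᵢ ∈ 𝓞 M` reduce to `ρᵢ ∈ 𝓞 M ⧸ W`, and
`g` permutes them (`perm4 g`) compatibly with the `Nv`-th power map.  Away from the finitely many
`W` containing `a₄`, `2` or some `xᵢ - xⱼ` we prove (Dedekind; Stickelberger):

* `fixedCard_perm4_eq` — the number of fixed points of `perm4 g` is the number of roots
  of `f mod v` in `𝓞 K ⧸ v`;
* `sign_perm4_eq_one_iff` — `sign (perm4 g) = 1` iff the discriminant of `f mod v`
  is a square in `𝓞 K ⧸ v`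

(the second in the sequel file `…FrobTable`, together with the conclusion
`inducedPoly_perm4_eq_table`: the induced local factor of the block-sign character at `perm4 g` is the
branch-point table polynomial of the route decl at `v`).  Unconditional.
-/

set_option linter.dupNamespace false -- project-wide option (lakefile weak.linter.dupNamespace); `Summit.Langlands.Langlands` is the mandated namespace

noncomputable section

namespace Summit.Langlands.Langlands.Theorems.ResidualAutomorphyEven

open Polynomial Equiv Finset NumberField Pairing
open scoped Classical

variable {f : ℤ[X]}

/-! ### The integral roots `xᵢ = a₄ rᵢ ∈ 𝓞 M` and the Galois action -/

/-- `xᵢ = a₄ rᵢ` as an algebraic integer of `M`. -/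
def xInt (h : IsSepQuartic f) (i : Fin 4) : 𝓞 (M f) :=
  ⟨lc f * rt h i, isIntegral_lc_mul_rt h i⟩

/-- Coercion of `xᵢ` to `M`. -/
@[simp] theorem coe_xInt (h : IsSepQuartic f) (i : Fin 4) : (xInt h i : M f) = lc f * rt h i := rfl

/-- **`G` permutes the integral roots through `perm4`**: `g • xᵢ = x_{perm4 g i}`. -/
theorem smul_xInt (h : IsSepQuartic f) (g : G f) (i : Fin 4) : g • xInt h i = xInt h (perm4 h g i) := by
  apply RingOfIntegers.ext
  rw [Literature.NumberTheory.Automorphic.RingOfIntegers.coe_algEquiv_smul, coe_xInt, coe_xInt,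
    map_mul, smul_lc, smul_rt]

/-- The integral roots are pairwise distinct (`a₄ ≠ 0`). -/
theorem xInt_injective (h : IsSepQuartic f) (hlc : f.leadingCoeff ≠ 0) : Function.Injective (xInt h) := by
  intro i j hij
  have := congrArg (fun x : 𝓞 (M f) => (x : M f)) hij
  simp only [coe_xInt] at this
  exact rt_injective h (mul_left_cancel₀ (lc_ne_zero hlc) this)

/-- The leading coefficient `a₄` as an algebraic integer of `M`. -/
def lcInt (f : ℤ[X]) : 𝓞 (M f) := algebraMap ℤ (𝓞 (M f)) f.leadingCoeff

/-- Coercion of `a₄`. -/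
@[simp] theorem coe_lcInt (f : ℤ[X]) : (lcInt f : M f) = lc f := by
  simp [lcInt, lc]

/-! ### Reduction modulo a prime `W` of `𝓞 M` with a Frobenius `g` -/

section Reduction

variable (h : IsSepQuartic f) (W : Ideal (𝓞 (M f))) (g : G f)

/-- The reduced roots `ρᵢ = xᵢ mod W`. -/
def rho (i : Fin 4) : 𝓞 (M f) ⧸ W := Ideal.Quotient.mk W (xInt h i)

/-- The residue characteristic power `q = N(W ∩ 𝓞 K)`. -/
def qW : ℕ := Nat.card (𝓞 K ⧸ W.under (𝓞 K))

variable {h W g}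

/-- **Frobenius compatibility**: `ρ_{perm4 g i} = ρᵢ ^ q` for an arithmetic Frobenius `g` at `W`. -/
theorem rho_perm4 (hg : IsArithFrobAt (𝓞 K) g W) (i : Fin 4) :
    rho h W (perm4 h g i) = rho h W i ^ qW W := by
  rw [rho, rho, qW, ← smul_xInt, ← hg.mk_apply]
  rfl

/-- Any element: `(y mod W) ^ q = (g • y) mod W`. -/
theorem mk_pow_qW (hg : IsArithFrobAt (𝓞 K) g W) (y : 𝓞 (M f)) :
    Ideal.Quotient.mk W y ^ qW W = Ideal.Quotient.mk W (g • y) := by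
  rw [qW, ← hg.mk_apply]; rfl

/-- The reduced roots are distinct when `W` contains no difference `xᵢ - xⱼ`. -/
theorem rho_injective (hW : ∀ i j, i ≠ j → xInt h i - xInt h j ∉ W) : Function.Injective (rho h W) := by
  intro i j hij
  by_contra hne
  exact hW i j hne ((Ideal.Quotient.eq).mp hij)

/-- **Fixed points of `perm4 g` are the `q`-power-fixed reduced roots.** -/
theorem perm4_eq_self_iff (hg : IsArithFrobAt (𝓞 K) g W) (hW : ∀ i j, i ≠ j → xInt h i - xInt h j ∉ W)
    (i : Fin 4) : perm4 h g i = i ↔ rho h W i ^ qW W = rho h W i := by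
  rw [← rho_perm4 hg, (rho_injective hW).eq_iff]

/-- **Frobenius multiplies `∏_{i<j} (ρⱼ - ρᵢ)` by the sign of `perm4 g`**:
`d ^ q = sign (perm4 g) · d` for `d = ∏_{i<j} (ρⱼ - ρᵢ)` (permute the Vandermonde determinant of the
integral roots and reduce). -/
theorem prodPairs_rho_pow (hg : IsArithFrobAt (𝓞 K) g W) :
    prodPairs (rho h W) ^ qW W = ((Perm.sign (perm4 h g) : ℤ) : 𝓞 (M f) ⧸ W) * prodPairs (rho h W) := by
  have h1 : prodPairs (rho h W) = Ideal.Quotient.mk W (prodPairs (xInt h)) := by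
    rw [map_prodPairs]; rfl
  have h2 : g • prodPairs (xInt h) = prodPairs (xInt h ∘ perm4 h g) := by
    rw [show g • prodPairs (xInt h) = MulSemiringAction.toRingHom (G f) (𝓞 (M f)) g (prodPairs (xInt h))
      from rfl, map_prodPairs]
    congr 1
    ext i
    exact congrArg (fun x : 𝓞 (M f) => (x : M f)) (smul_xInt h g i)
  rw [h1, mk_pow_qW hg, h2, prodPairs_comp_perm, map_mul, map_intCast]

end Reduction

/-! ### The quartic over `𝓞 M` and over `M`: `a₄³ f = ∏ (a₄ X - xᵢ)` -/

/-- `f ⊗ M`. -/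
abbrev fM (f : ℤ[X]) : (M f)[X] := f.map (algebraMap ℤ (M f))

/-- `f ⊗ M = (f ⊗ K) ⊗ M`. -/
theorem fM_eq_map (f : ℤ[X]) : fM f = (fK f).map (algebraMap K (M f)) := by
  show f.map (algebraMap ℤ (M f)) = (f.map (algebraMap ℤ K)).map (algebraMap K (M f))
  rw [Polynomial.map_map, ← IsScalarTower.algebraMap_eq]

/-- The roots of `f ⊗ M` are the `rᵢ` (as a multiset). -/
theorem roots_fM (h : IsSepQuartic f) : (fM f).roots = (univ : Finset (Fin 4)).val.map (rt h) := by
  have hnd : (fM f).roots.Nodup := by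
    rw [fM_eq_map]; exact nodup_roots h.2.map
  have hnd' : ((univ : Finset (Fin 4)).val.map (rt h)).Nodup :=
    (Multiset.Nodup.map (rt_injective h) univ.nodup)
  refine (Multiset.Nodup.ext hnd hnd').mpr fun a => ?_
  rw [Multiset.mem_map]
  constructor
  · intro ha
    have ha' : a ∈ (fK f).rootSet (M f) := by
      rw [mem_rootSet']
      refine ⟨by rw [← fM_eq_map]; exact ne_zero_of_mem_roots ha, ?_⟩
      have := (mem_roots (ne_zero_of_mem_roots ha)).mp ha
      rwa [IsRoot, fM_eq_map, eval_map_algebraMap] at this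
    refine ⟨rootEnum h ⟨a, ha'⟩, Finset.mem_univ_val _, ?_⟩
    rw [rt, Equiv.symm_apply_apply]
  · rintro ⟨i, -, rfl⟩
    have hi := ((rootEnum h).symm i).2
    rw [mem_rootSet'] at hi
    rw [mem_roots (by rw [fM_eq_map]; exact hi.1), IsRoot, fM_eq_map, eval_map_algebraMap]
    exact hi.2

/-- **`f ⊗ M = a₄ ∏ (X - rᵢ)`.** -/
theorem fM_eq_prod (h : IsSepQuartic f) : fM f = C (lc f) * ∏ i : Fin 4, (X - C (rt h i)) := by
  have hsplit : (fM f).Splits := by rw [fM_eq_map]; exact SplittingField.splits (fK f)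
  have hlc : (fM f).leadingCoeff = lc f := by
    rw [fM, lc, leadingCoeff_map_of_injective (algebraMap ℤ (M f)).injective_int]
  conv_lhs => rw [hsplit.eq_prod_roots, hlc, roots_fM h, Multiset.map_map, ← Finset.prod_eq_multiset_prod]
  rfl

/-- **`a₄³ · (f ⊗ 𝓞 M) = ∏ (a₄ X - xᵢ)` in `𝓞 M[X]`** (checked in `M[X]`). -/
theorem C_pow_mul_map_eq_prod (h : IsSepQuartic f) :
    C (lcInt f) ^ 3 * f.map (algebraMap ℤ (𝓞 (M f))) = ∏ i : Fin 4, (C (lcInt f) * X - C (xInt h i)) := by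
  apply Polynomial.map_injective (algebraMap (𝓞 (M f)) (M f)) (FaithfulSMul.algebraMap_injective _ _)
  rw [Polynomial.map_mul, Polynomial.map_pow, map_C, Polynomial.map_map,
    show (algebraMap (𝓞 (M f)) (M f)).comp (algebraMap ℤ (𝓞 (M f))) = algebraMap ℤ (M f)
      from RingHom.ext_int _ _, Polynomial.map_prod]
  simp only [Polynomial.map_sub, Polynomial.map_mul, map_C, map_X]
  rw [show (algebraMap (𝓞 (M f)) (M f)) (lcInt f) = lc f from coe_lcInt f]
  simp only [show ∀ i, (algebraMap (𝓞 (M f)) (M f)) (xInt h i) = lc f * rt h i from fun i => rfl]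
  rw [show (f.map (algebraMap ℤ (M f))) = fM f from rfl, fM_eq_prod h]
  have : ∀ i : Fin 4, (C (lc f) * X - C (lc f * rt h i) : (M f)[X]) = C (lc f) * (X - C (rt h i)) := by
    intro i; rw [C_mul, mul_sub]
  simp only [this, Finset.prod_mul_distrib, Finset.prod_const, Finset.card_univ, Fintype.card_fin]
  ring

/-! ### Over the residue fields: `k_v = 𝓞 K ⧸ v ↪ k = 𝓞 M ⧸ W` -/

section Residue

-- residue rings of maximal ideals are fields (Mathlib keeps this a `def` to avoid diamonds)
attribute [local instance] Ideal.Quotient.field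

variable (h : IsSepQuartic f) (W : Ideal (𝓞 (M f))) (v : IsDedekindDomain.HeightOneSpectrum (𝓞 K))
  (hv : v.asIdeal = W.under (𝓞 K))

/-- `f mod v` over `k_v = 𝓞 K ⧸ v` (verbatim the polynomial of the route decl's table). -/
abbrev fbar (f : ℤ[X]) (v : IsDedekindDomain.HeightOneSpectrum (𝓞 K)) : (𝓞 K ⧸ v.asIdeal)[X] :=
  f.map ((Ideal.Quotient.mk v.asIdeal).comp (algebraMap ℤ (𝓞 K)))

include hv in
/-- `v ≤ W ∩ 𝓞 K`. -/
theorem le_comap : v.asIdeal ≤ W.comap (algebraMap (𝓞 K) (𝓞 (M f))) := hv.le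

/-- The residue field embedding `ι : 𝓞 K ⧸ v →+* 𝓞 M ⧸ W`. -/
def iota : 𝓞 K ⧸ v.asIdeal →+* 𝓞 (M f) ⧸ W := Ideal.quotientMap W (algebraMap (𝓞 K) (𝓞 (M f))) (le_comap W v hv)

/-- `ι` on representatives. -/
theorem iota_mk (x : 𝓞 K) : iota W v hv (Ideal.Quotient.mk v.asIdeal x) =
    Ideal.Quotient.mk W (algebraMap (𝓞 K) (𝓞 (M f)) x) := Ideal.quotientMap_mk

/-- `ι` is injective (a homomorphism of fields). -/
theorem iota_injective [W.IsMaximal] : Function.Injective (iota W v hv) := by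
  haveI := v.isMaximal
  exact (iota W v hv).injective

/-- `(f mod v) ⊗ k = f mod W`. -/
theorem fbar_map_iota : (fbar f v).map (iota W v hv) = (f.map (algebraMap ℤ (𝓞 (M f)))).map (Ideal.Quotient.mk W) := by
  rw [Polynomial.map_map, Polynomial.map_map]
  exact congrArg (Polynomial.map · f) (RingHom.ext_int _ _)

/-- `a₄ mod W`. -/
def abar : 𝓞 (M f) ⧸ W := Ideal.Quotient.mk W (lcInt f)

/-- `a₄ mod v`. -/
def abarv (f : ℤ[X]) (v : IsDedekindDomain.HeightOneSpectrum (𝓞 K)) : 𝓞 K ⧸ v.asIdeal :=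
  Ideal.Quotient.mk v.asIdeal (algebraMap ℤ (𝓞 K) f.leadingCoeff)

/-- `a₄ mod W` is the image of `a₄ mod v`. -/
theorem iota_abarv : iota W v hv (abarv f v) = abar W := by
  rw [abarv, iota_mk, abar, lcInt, ← IsScalarTower.algebraMap_apply]

/-- **The reduced identity `ā³ · (f mod W) = ∏ (ā X - ρᵢ)`.** -/
theorem C_abar_pow_mul_eq_prod :
    C (abar W) ^ 3 * (fbar f v).map (iota W v hv) = ∏ i : Fin 4, (C (abar W) * X - C (rho h W i)) := by
  rw [fbar_map_iota]
  have := congrArg (Polynomial.map (Ideal.Quotient.mk W)) (C_pow_mul_map_eq_prod h)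
  rw [Polynomial.map_mul, Polynomial.map_pow, map_C, Polynomial.map_prod] at this
  simp only [Polynomial.map_sub, Polynomial.map_mul, map_C, map_X] at this
  exact this

/-- Roots of `f mod W`: `(f mod v)(z) = 0` in `k` iff `ā z` is one of the `ρᵢ` (for `ā ≠ 0`). -/
theorem eval_fbar_map_eq_zero_iff [W.IsMaximal] (ha : abar W ≠ 0) (z : 𝓞 (M f) ⧸ W) :
    ((fbar f v).map (iota W v hv)).eval z = 0 ↔ ∃ i : Fin 4, rho h W i = abar W * z := by
  have key := congrArg (Polynomial.eval z) (C_abar_pow_mul_eq_prod h W v hv)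
  simp only [eval_mul, eval_pow, eval_C, eval_prod, eval_sub, eval_X] at key
  constructor
  · intro hz
    rw [hz, mul_zero] at key
    obtain ⟨i, -, hi⟩ := Finset.prod_eq_zero_iff.mp key.symm
    exact ⟨i, (sub_eq_zero.mp hi).symm⟩
  · rintro ⟨i, hi⟩
    have h0 : ∏ i : Fin 4, (abar W * z - rho h W i) = 0 :=
      Finset.prod_eq_zero (Finset.mem_univ i) (by rw [hi, sub_self])
    rw [h0, mul_eq_zero] at key
    exact key.resolve_left (pow_ne_zero _ ha)

include h hv in
/-- `f mod v ≠ 0` when `ā ≠ 0`. -/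
theorem fbar_ne_zero [W.IsMaximal] (ha : abar W ≠ 0) : fbar f v ≠ 0 := by
  intro h0
  have key := C_abar_pow_mul_eq_prod h W v hv
  rw [h0, Polynomial.map_zero, mul_zero] at key
  refine (Finset.prod_ne_zero_iff.mpr fun i _ => ?_) key.symm
  intro hi
  have := congrArg (fun p : (𝓞 (M f) ⧸ W)[X] => p.coeff 1) hi
  simp only [coeff_sub, coeff_C_mul, coeff_X_one, mul_one, coeff_C_succ, sub_zero, coeff_zero] at this
  exact ha this

include hv in
/-- `q = #k_v`. -/
theorem qW_eq_card : qW W = Nat.card (𝓞 K ⧸ v.asIdeal) := by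
  rw [qW, ← hv]

/-- **Fixed points of Frobenius ↔ reduced roots in `k_v`** (Dedekind): `perm4 g i = i` iff `ρᵢ` lies in
the image of `k_v`. -/
theorem perm4_eq_self_iff_mem_range [W.IsMaximal] {g : G f}
    (hg : IsArithFrobAt (𝓞 K) g W) (hW : ∀ i j, i ≠ j → xInt h i - xInt h j ∉ W) (i : Fin 4) :
    perm4 h g i = i ↔ rho h W i ∈ Set.range (iota W v hv) := by
  haveI := v.isMaximal
  rw [perm4_eq_self_iff hg hW, qW_eq_card W v hv, FiniteField.mem_range_iff_pow_card_eq]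

include hv in
/-- **`#Fix(perm4 g) = #roots of (f mod v) in k_v`**: both sets are in bijection with
`{ρᵢ} ∩ ā · ι(k_v) ⊆ k` (`y ↦ ā ι(y)`, resp. `i ↦ ρᵢ`). -/
theorem fixedCard_perm4_eq [W.IsMaximal] {g : G f}
    (hg : IsArithFrobAt (𝓞 K) g W) (hW : ∀ i j, i ≠ j → xInt h i - xInt h j ∉ W) (ha : abar W ≠ 0) :
    fixedCard (perm4 h g) = ((fbar f v).roots.toFinset).card := by
  haveI := v.isMaximal
  have hinj := iota_injective W v hv
  have hρ := rho_injective (h := h) hW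
  have haι := iota_abarv W v hv
  have ha0 : abarv f v ≠ 0 := fun h0 => ha (by rw [← haι, h0, map_zero])
  have hfbar0 := fbar_ne_zero h W v hv ha
  -- images in `k`
  set A := (fbar f v).roots.toFinset with hA
  set B := (univ : Finset (Fin 4)).filter fun i => perm4 h g i = i with hB
  have hmap : ∀ y, ((fbar f v).map (iota W v hv)).eval (iota W v hv y) = iota W v hv ((fbar f v).eval y) :=
    fun y => by rw [eval_map, eval₂_hom]
  have hmemA : ∀ y, y ∈ A ↔ ((fbar f v).map (iota W v hv)).eval (iota W v hv y) = 0 := by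
    intro y
    rw [hmap, map_eq_zero_iff _ hinj, hA, Multiset.mem_toFinset, mem_roots hfbar0, IsRoot.def]
  have himg : A.image (fun y => abar W * iota W v hv y) = B.image (rho h W) := by
    ext z
    simp only [Finset.mem_image, hB, Finset.mem_filter, Finset.mem_univ, true_and]
    constructor
    · rintro ⟨y, hy, rfl⟩
      obtain ⟨i, hi⟩ := (eval_fbar_map_eq_zero_iff h W v hv ha _).mp ((hmemA y).mp hy)
      refine ⟨i, (perm4_eq_self_iff_mem_range h W v hv hg hW i).mpr ⟨abarv f v * y, ?_⟩, hi⟩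
      rw [map_mul, haι, hi]
    · rintro ⟨i, hi, rfl⟩
      obtain ⟨t, ht⟩ := (perm4_eq_self_iff_mem_range h W v hv hg hW i).mp hi
      refine ⟨(abarv f v)⁻¹ * t, ?_, ?_⟩
      · rw [hmemA]
        exact (eval_fbar_map_eq_zero_iff h W v hv ha _).mpr
          ⟨i, by rw [map_mul, map_inv₀, haι, ht, mul_inv_cancel_left₀ ha]⟩
      · rw [map_mul, map_inv₀, haι, ht, mul_inv_cancel_left₀ ha]
  have hcardA : (A.image fun y => abar W * iota W v hv y).card = A.card :=
    Finset.card_image_of_injective _ fun y₁ y₂ hy => hinj (mul_left_cancel₀ ha hy)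
  have hcardB : (B.image (rho h W)).card = B.card := Finset.card_image_of_injective _ hρ
  rw [fixedCard, ← hB, ← hcardB, ← himg, hcardA]

end Residue

end Summit.Langlands.Langlands.Theorems.ResidualAutomorphyEven
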